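import HarnessLib
import Literature.Analysis.FluidPDE.VectorCalculus
import Literature.Analysis.FluidPDE.VorticityStretching
import Literature.Analysis.FluidPDE.WholeSpaceIBP
import Literature.Analysis.Calculus.MvPolynomialFDeriv
import Literature.Analysis.ValidatedNumerics.SparsePolynomialEnclosure

/-!
# Calculus of polynomial vector fields on `ℝ³` and exact term-list PDE certificates

Analysis/FluidPDE support file (everything proved; the definitions are computational data structures, no
mathematical notion and no named fact is introduced). Requested by the STAGED door route `PoloidalWindowDoor` of
`NavierStokesRegularity` (cell ns-regularity-ideate, crux K2 `PoloidalWindowRigidity`): its kernel certificate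
`Summits/…/Theorems/PoloidalWindowDoorPoloidalWindowRigidityLinearNonrigidity` (an explicit polynomial solution of
the Navier–Stokes system linearised at an explicit polynomial steady solution) needs a bridge turning `convect`,
`gradient`, `curl`, `div`, `Δ` of vector fields with POLYNOMIAL components into evaluations of formal partial
derivatives (`Literature.Analysis.Calculus.MvPoly.toFun`, `MvPolynomial.pderiv`; file
`Analysis/Calculus/MvPolynomialFDeriv`), and then into EXACT RATIONAL TERM LISTS
(`Literature.Analysis.ValidatedNumerics.QMvPoly`: `mul`, `pderivQ`, `smul`, `normalize`; file
`Analysis/ValidatedNumerics/SparsePolynomialEnclosure`), so that a PDE identity between polynomial fields becomes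
`normalize (residual list) = []`, decidable by the kernel (`decide +kernel`; no `native_decide`).

* `polyField P` (components `toFun (P i)`), `contDiff_polyField`, `fderiv_polyField_single/apply`,
  `divergence_polyField`, `curl_polyField_apply_two`, `convect_polyField_apply`, `laplacian_toFun'`,
  `laplacian_polyField_apply`, `gradient_toFun_apply`;
* term lists: `mv` (= `QMvPoly.toMv ℝ 3`), `qField`, `qScalar`, residual lists `advQ`, `lapQ`, `nsResQ` (steady
  Navier–Stokes momentum `(U·∇)U + ∇P − ΔU`, viscosity `1`), `linResQ` (linearised momentum
  `(U·∇)V + (V·∇)U + ∇q − ΔV`), `divQ`, `curl2Q`, with their semantics (`toFun_advQ`, `toFun_lapQ`, …);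
* certificate theorems: `steadyNS_of_cert`, `linearised_of_cert`, `divergence_of_cert`, `curl_two_of_cert`,
  `fderiv_single_of_cert`; point evaluation `toFun_mv_eq_sum`.

References: calculus of polynomials [folklore]; the convective derivative, divergence, curl and Laplacian in
coordinates, A. J. Majda, A. L. Bertozzi, *Vorticity and Incompressible Flow* (CUP 2002), §1.1
[MajdaBertozziCUP2002].
-/

noncomputable section

namespace Literature.Analysis.FluidPDE.PolyFieldCert

open scoped RealInnerProductSpace InnerProductSpace ContDiff Laplacian
open Literature.Analysis Literature.Analysis.FluidPDE
open Literature.Analysis.Calculus.MvPoly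
open Literature.Analysis.ValidatedNumerics Literature.Analysis.ValidatedNumerics.QMvPoly

/-! ### Generic bridge: calculus of polynomial vector fields on `ℝ³` -/

section PolyField

/-- The vector field on `ℝ³` whose components are the polynomial functions of `P 0, P 1, P 2`. [folklore] -/
def polyField (P : Fin 3 → MvPolynomial (Fin 3) ℝ) (x : EuclideanSpace ℝ (Fin 3)) : EuclideanSpace ℝ (Fin 3) :=
  WithLp.toLp 2 fun i => toFun (P i) x

variable (P : Fin 3 → MvPolynomial (Fin 3) ℝ)

/-- Components of `polyField`. [cite: MajdaBertozziCUP2002, §1.1 (vector identities)] -/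
@[simp] theorem polyField_apply (x : EuclideanSpace ℝ (Fin 3)) (i : Fin 3) :
    polyField P x i = toFun (P i) x := rfl

/-- Polynomial vector fields are smooth. [cite: MajdaBertozziCUP2002, §1.1 (vector identities)] -/
theorem contDiff_polyField {m : WithTop ℕ∞} : ContDiff ℝ m (polyField P) := by
  rw [contDiff_euclidean]
  intro i
  exact contDiff_toFun (P i)

/-- `∂ⱼ` of the `i`-th component of a polynomial field is the polynomial function of `∂ⱼ Pᵢ`. [cite: MajdaBertozziCUP2002, §1.1 (vector identities)] -/
theorem fderiv_polyField_single (x : EuclideanSpace ℝ (Fin 3)) (j i : Fin 3) :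
    fderiv ℝ (polyField P) x (EuclideanSpace.single j 1) i = toFun (MvPolynomial.pderiv j (P i)) x := by
  have hd : DifferentiableAt ℝ (polyField P) x := (contDiff_polyField P (m := 1)).differentiable one_ne_zero x
  have h1 : fderiv ℝ (fun y => polyField P y i) x =
      (EuclideanSpace.proj i : EuclideanSpace ℝ (Fin 3) →L[ℝ] ℝ).comp (fderiv ℝ (polyField P) x) := by
    have e : (fun y => polyField P y i) = (EuclideanSpace.proj i : EuclideanSpace ℝ (Fin 3) →L[ℝ] ℝ) ∘ polyField P :=
      rfl
    rw [e, fderiv_comp x (EuclideanSpace.proj i : EuclideanSpace ℝ (Fin 3) →L[ℝ] ℝ).differentiableAt hd,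
      ContinuousLinearMap.fderiv]
  have h2 : fderiv ℝ (fun y => polyField P y i) x (EuclideanSpace.single j 1) =
      fderiv ℝ (polyField P) x (EuclideanSpace.single j 1) i := by
    rw [h1]; rfl
  rw [← h2]
  exact fderiv_toFun_single (P i) x j

/-- General directional derivative of a component: `D(polyField P)(x)[v]ᵢ = Σⱼ vⱼ (∂ⱼPᵢ)(x)`. [cite: MajdaBertozziCUP2002, §1.1 (vector identities)] -/
theorem fderiv_polyField_apply (x v : EuclideanSpace ℝ (Fin 3)) (i : Fin 3) :
    fderiv ℝ (polyField P) x v i = ∑ j, v j * toFun (MvPolynomial.pderiv j (P i)) x := by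
  rw [clm_apply_coord (fderiv ℝ (polyField P) x) v i]
  exact Finset.sum_congr rfl fun j _ => by rw [fderiv_polyField_single]

/-- Divergence of a polynomial field. [cite: MajdaBertozziCUP2002, §1.1 (vector identities)] -/
theorem divergence_polyField (x : EuclideanSpace ℝ (Fin 3)) :
    VectorCalculus.divergence (polyField P) x = ∑ i, toFun (MvPolynomial.pderiv i (P i)) x := by
  rw [VectorCalculus.divergence, trace_eq_sum_coord]
  exact Finset.sum_congr rfl fun i _ => fderiv_polyField_single P x i i

/-- Vertical component of the curl of a polynomial field: `(curl V)₂ = ∂₀V₁ − ∂₁V₀`. [cite: MajdaBertozziCUP2002, §1.1 (vector identities)] -/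
theorem curl_polyField_apply_two (x : EuclideanSpace ℝ (Fin 3)) :
    curl (polyField P) x 2 =
      toFun (MvPolynomial.pderiv 0 (P 1)) x - toFun (MvPolynomial.pderiv 1 (P 0)) x := by
  rw [curl_eq_curlCLM, curlCLM_apply]
  simp [fderiv_polyField_single]

/-- Convective derivative of a polynomial field along any field `a`: `((a·∇)V)ᵢ = Σⱼ aⱼ ∂ⱼVᵢ`. [cite: MajdaBertozziCUP2002, §1.1 (vector identities)] -/
theorem convect_polyField_apply (a : EuclideanSpace ℝ (Fin 3) → EuclideanSpace ℝ (Fin 3))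
    (x : EuclideanSpace ℝ (Fin 3)) (i : Fin 3) :
    convect a (polyField P) x i = ∑ j, a x j * toFun (MvPolynomial.pderiv j (P i)) x := by
  rw [convect]
  exact fderiv_polyField_apply P x (a x) i

/-- Laplacian of a polynomial function: `Δ(P)(x) = (Σₖ ∂ₖ∂ₖ P)(x)`. [cite: MajdaBertozziCUP2002, §1.1 (vector identities)] -/
theorem laplacian_toFun' (p : MvPolynomial (Fin 3) ℝ) (x : EuclideanSpace ℝ (Fin 3)) :
    (Δ (toFun p)) x = toFun (∑ k, MvPolynomial.pderiv k (MvPolynomial.pderiv k p)) x := by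
  rw [laplacian_eq_sum_fderiv_fderiv (EuclideanSpace.basisFun (Fin 3) ℝ) (contDiff_toFun p) x, toFun_sum]
  refine Finset.sum_congr rfl fun k _ => ?_
  have hb : (EuclideanSpace.basisFun (Fin 3) ℝ) k = EuclideanSpace.single k 1 := by simp
  rw [hb, show (fun y => fderiv ℝ (toFun p) y (EuclideanSpace.single k 1)) = toFun (MvPolynomial.pderiv k p) from
    funext fun y => fderiv_toFun_single p y k, fderiv_toFun_single]

/-- Components of the Laplacian of a polynomial field. [cite: MajdaBertozziCUP2002, §1.1 (vector identities)] -/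
theorem laplacian_polyField_apply (x : EuclideanSpace ℝ (Fin 3)) (i : Fin 3) :
    (Δ (polyField P)) x i = toFun (∑ k, MvPolynomial.pderiv k (MvPolynomial.pderiv k (P i))) x := by
  have h : (fun y => polyField P y i) = (EuclideanSpace.proj i : EuclideanSpace ℝ (Fin 3) →L[ℝ] ℝ) ∘ polyField P :=
    rfl
  have h2 : (Δ (polyField P)) x i = (Δ (fun y => polyField P y i)) x := by
    rw [h, ContDiffAt.laplacian_CLM_comp_left ((contDiff_polyField P (m := 2)).contDiffAt)]
    rfl
  rw [h2]
  exact laplacian_toFun' (P i) x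

end PolyField

/-- Gradient components of a polynomial function: `(∇P)(x)ᵢ = (∂ᵢP)(x)`. [cite: MajdaBertozziCUP2002, §1.1 (vector identities)] -/
theorem gradient_toFun_apply (p : MvPolynomial (Fin 3) ℝ) (x : EuclideanSpace ℝ (Fin 3)) (i : Fin 3) :
    gradient (toFun p) x i = toFun (MvPolynomial.pderiv i p) x := by
  have e : gradient (toFun p) x i = ⟪gradient (toFun p) x, EuclideanSpace.single i (1 : ℝ)⟫_ℝ := by
    rw [EuclideanSpace.inner_single_right]; simp
  rw [e, gradient, InnerProductSpace.toDual_symm_apply, fderiv_toFun_single]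

/-! ### Term-list (exact rational) residuals and their semantics -/

/-- The real polynomial of a term list (three variables). [folklore] -/
abbrev mv (p : QMvPoly) : MvPolynomial (Fin 3) ℝ := QMvPoly.toMv ℝ 3 p

/-- The vector field of three term lists. [folklore] -/
def qField (A : Fin 3 → QMvPoly) : EuclideanSpace ℝ (Fin 3) → EuclideanSpace ℝ (Fin 3) :=
  polyField fun i => mv (A i)

/-- The scalar function of a term list. [folklore] -/
def qScalar (q : QMvPoly) : EuclideanSpace ℝ (Fin 3) → ℝ := toFun (mv q)

/-- `∂₀` on term lists agrees with `pderiv 0`. [cite: Moore1979, §3.4 eq. (3.18)] -/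
theorem mv_pderivQ0 (p : QMvPoly) : mv (pderivQ 0 p) = MvPolynomial.pderiv 0 (mv p) :=
  toMv_pderivQ ℝ 3 (0 : Fin 3) p
/-- `∂₁` on term lists agrees with `pderiv 1`. [cite: Moore1979, §3.4 eq. (3.18)] -/
theorem mv_pderivQ1 (p : QMvPoly) : mv (pderivQ 1 p) = MvPolynomial.pderiv 1 (mv p) :=
  toMv_pderivQ ℝ 3 (1 : Fin 3) p
/-- `∂₂` on term lists agrees with `pderiv 2`. [cite: Moore1979, §3.4 eq. (3.18)] -/
theorem mv_pderivQ2 (p : QMvPoly) : mv (pderivQ 2 p) = MvPolynomial.pderiv 2 (mv p) :=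
  toMv_pderivQ ℝ 3 (2 : Fin 3) p

/-- Term list of `((A·∇)B)ᵢ = Σⱼ Aⱼ ∂ⱼBᵢ`. [folklore] -/
def advQ (A B : Fin 3 → QMvPoly) (i : Fin 3) : QMvPoly :=
  mul (A 0) (pderivQ 0 (B i)) ++ (mul (A 1) (pderivQ 1 (B i)) ++ mul (A 2) (pderivQ 2 (B i)))

/-- Term list of `ΔP = Σₖ ∂ₖ∂ₖP`. [folklore] -/
def lapQ (q : QMvPoly) : QMvPoly :=
  pderivQ 0 (pderivQ 0 q) ++ (pderivQ 1 (pderivQ 1 q) ++ pderivQ 2 (pderivQ 2 q))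

/-- Term list of the steady Navier–Stokes momentum residual `((U·∇)U + ∇P − ΔU)ᵢ` (viscosity `1`). [folklore] -/
def nsResQ (U : Fin 3 → QMvPoly) (q : QMvPoly) (i : Fin 3) : QMvPoly :=
  advQ U U i ++ (pderivQ i q ++ smul (-1) (lapQ (U i)))

/-- Term list of the LINEARISED momentum residual `((U·∇)V + (V·∇)U + ∇q − ΔV)ᵢ` at the base `U`. [folklore] -/
def linResQ (U V : Fin 3 → QMvPoly) (q : QMvPoly) (i : Fin 3) : QMvPoly :=
  advQ U V i ++ (advQ V U i ++ (pderivQ i q ++ smul (-1) (lapQ (V i))))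

/-- Term list of `div V`. [folklore] -/
def divQ (V : Fin 3 → QMvPoly) : QMvPoly :=
  pderivQ 0 (V 0) ++ (pderivQ 1 (V 1) ++ pderivQ 2 (V 2))

/-- Term list of `(curl V)₂ = ∂₀V₁ − ∂₁V₀`. [folklore] -/
def curl2Q (V : Fin 3 → QMvPoly) : QMvPoly :=
  pderivQ 0 (V 1) ++ smul (-1) (pderivQ 1 (V 0))

/-- A term list whose normal form is empty represents the zero polynomial. [cite: Moore1979, §3.4 eq. (3.18)] -/
theorem mv_eq_zero_of_normalize {p : QMvPoly} (h : normalize p = []) : mv p = 0 := by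
  rw [mv, ← toMv_normalize, h, toMv_nil]

/-- `pderivQ i` for `i : Fin 3`. [cite: Moore1979, §3.4 eq. (3.18)] -/
theorem mv_pderivQ_fin (i : Fin 3) (p : QMvPoly) : mv (pderivQ i p) = MvPolynomial.pderiv i (mv p) :=
  toMv_pderivQ ℝ 3 i p

/-- Semantics of `advQ`. [cite: Moore1979, §3.4 eq. (3.18)] -/
theorem toFun_advQ (A B : Fin 3 → QMvPoly) (i : Fin 3) (x : EuclideanSpace ℝ (Fin 3)) :
    toFun (mv (advQ A B i)) x = ∑ j, toFun (mv (A j)) x * toFun (MvPolynomial.pderiv j (mv (B i))) x := by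
  rw [advQ, mv, toMv_append, toMv_append, toMv_mul, toMv_mul, toMv_mul, Fin.sum_univ_three]
  rw [← mv, ← mv, ← mv, ← mv, ← mv, ← mv, mv_pderivQ0, mv_pderivQ1, mv_pderivQ2]
  simp only [toFun_add, toFun_mul]
  ring

/-- Semantics of `lapQ`. [cite: Moore1979, §3.4 eq. (3.18)] -/
theorem toFun_lapQ (q : QMvPoly) (x : EuclideanSpace ℝ (Fin 3)) :
    toFun (mv (lapQ q)) x = toFun (∑ k, MvPolynomial.pderiv k (MvPolynomial.pderiv k (mv q))) x := by
  rw [lapQ, mv, toMv_append, toMv_append, Fin.sum_univ_three]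
  rw [← mv, ← mv, ← mv, mv_pderivQ0, mv_pderivQ0, mv_pderivQ1, mv_pderivQ1, mv_pderivQ2, mv_pderivQ2, add_assoc]

/-- Semantics of `smul (-1)`. [cite: Moore1979, §3.4 eq. (3.18)] -/
theorem toFun_mv_smul_neg_one (p : QMvPoly) (x : EuclideanSpace ℝ (Fin 3)) :
    toFun (mv (smul (-1) p)) x = -toFun (mv p) x := by
  rw [mv, toMv_smul, toFun_smul]
  push_cast
  ring

/-- **Certificate ⇒ steady Navier–Stokes.** If the three momentum residual lists and the divergence list normalise
to `[]`, the polynomial field/pressure solve `(U·∇)U + ∇P = ΔU`, `div U = 0` on `ℝ³`. [cite: MajdaBertozziCUP2002, §1.1 (vector identities)] -/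
theorem steadyNS_of_cert (U : Fin 3 → QMvPoly) (q : QMvPoly)
    (h : ∀ i : Fin 3, normalize (nsResQ U q i) = []) (x : EuclideanSpace ℝ (Fin 3)) :
    convect (qField U) (qField U) x + gradient (qScalar q) x = (Δ (qField U)) x := by
  ext i
  have key := congrArg (fun r => toFun r x) (mv_eq_zero_of_normalize (h i))
  simp only [nsResQ, mv, toMv_append] at key
  rw [← mv, ← mv, ← mv, toFun_add, toFun_add, toFun_advQ, toFun_mv_smul_neg_one, toFun_lapQ, mv_pderivQ_fin,
    toFun_zero] at key
  rw [PiLp.add_apply, qField, convect_polyField_apply, laplacian_polyField_apply, qScalar, gradient_toFun_apply]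
  simp only [polyField_apply]
  linarith

/-- **Certificate ⇒ linearised equations.** [cite: MajdaBertozziCUP2002, §1.1 (vector identities)] -/
theorem linearised_of_cert (U V : Fin 3 → QMvPoly) (q : QMvPoly)
    (h : ∀ i : Fin 3, normalize (linResQ U V q i) = []) (x : EuclideanSpace ℝ (Fin 3)) :
    convect (qField U) (qField V) x + convect (qField V) (qField U) x + gradient (qScalar q) x =
      (Δ (qField V)) x := by
  ext i
  have key := congrArg (fun r => toFun r x) (mv_eq_zero_of_normalize (h i))
  simp only [linResQ, mv, toMv_append] at key
  rw [← mv, ← mv, ← mv, ← mv, toFun_add, toFun_add, toFun_add, toFun_advQ, toFun_advQ, toFun_mv_smul_neg_one,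
    toFun_lapQ, mv_pderivQ_fin, toFun_zero] at key
  rw [PiLp.add_apply, PiLp.add_apply, qField, qField, convect_polyField_apply, convect_polyField_apply,
    laplacian_polyField_apply, qScalar, gradient_toFun_apply]
  simp only [polyField_apply]
  linarith

/-- **Certificate ⇒ divergence free.** [cite: MajdaBertozziCUP2002, §1.1 (vector identities)] -/
theorem divergence_of_cert (V : Fin 3 → QMvPoly) (h : normalize (divQ V) = []) (x : EuclideanSpace ℝ (Fin 3)) :
    VectorCalculus.divergence (qField V) x = 0 := by
  have key := congrArg (fun r => toFun r x) (mv_eq_zero_of_normalize h)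
  simp only [divQ, mv, toMv_append] at key
  rw [← mv, ← mv, ← mv, toFun_add, toFun_add, mv_pderivQ0, mv_pderivQ1, mv_pderivQ2, toFun_zero] at key
  rw [qField, divergence_polyField, Fin.sum_univ_three, ← add_assoc] at *
  simpa using key

/-- **Certificate ⇒ vanishing vertical vorticity.** [cite: MajdaBertozziCUP2002, §1.1 (vector identities)] -/
theorem curl_two_of_cert (V : Fin 3 → QMvPoly) (h : normalize (curl2Q V) = []) (x : EuclideanSpace ℝ (Fin 3)) :
    curl (qField V) x 2 = 0 := by
  have key := congrArg (fun r => toFun r x) (mv_eq_zero_of_normalize h)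
  simp only [curl2Q, mv, toMv_append] at key
  rw [← mv, ← mv, toFun_add, toFun_mv_smul_neg_one, mv_pderivQ0, mv_pderivQ1, toFun_zero] at key
  rw [qField, curl_polyField_apply_two]
  simpa [sub_eq_add_neg] using key

/-- **Certificate ⇒ a directional derivative of a polynomial field is another polynomial field.** [cite: MajdaBertozziCUP2002, §1.1 (vector identities)] -/
theorem fderiv_single_of_cert (V T : Fin 3 → QMvPoly) (j : Fin 3)
    (h : ∀ i : Fin 3, normalize (pderivQ j (V i) ++ smul (-1) (T i)) = []) (x : EuclideanSpace ℝ (Fin 3)) :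
    fderiv ℝ (qField V) x (EuclideanSpace.single j 1) = qField T x := by
  ext i
  have key := congrArg (fun r => toFun r x) (mv_eq_zero_of_normalize (h i))
  simp only [mv, toMv_append] at key
  rw [← mv, ← mv, toFun_add, toFun_mv_smul_neg_one, mv_pderivQ_fin, toFun_zero] at key
  rw [qField, fderiv_polyField_single, qField, polyField_apply]
  linarith

/-- Value of a term-list polynomial at a point, term by term (for point evaluations). [cite: Moore1979, §3.4 eq. (3.18)] -/
theorem toFun_mv_eq_sum (p : QMvPoly) (x : EuclideanSpace ℝ (Fin 3)) :
    toFun (mv p) x = (p.map fun t => (t.2 : ℝ) * ∏ i : Fin 3, x i ^ t.1.getD i 0).sum := by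
  induction p with
  | nil => simp [mv]
  | cons t p ih =>
      rw [List.map_cons, List.sum_cons, ← ih, mv, toFun_apply, eval_toMv_cons, ← toFun_apply, ← mv]


end Literature.Analysis.FluidPDE.PolyFieldCert

end
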